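import Summits.NavierStokesRegularity.NavierStokesRegularity.Theses.CertifiedBlowup
import Summits.NavierStokesRegularity.NavierStokesRegularity.Theorems.CertifiedBlowupCertifiedBlowupAxisymBlowupAmplificationOfKato
import Summits.NavierStokesRegularity.NavierStokesRegularity.Theorems.CertifiedBlowupCertifiedBlowupAxisymBlowupAmplificationOfRescale
import Literature.Analysis.FluidPDE.AxisymmetricVorticityTransport
import Literature.Analysis.FluidPDE.PressurePoisson

/-!
# Crux `CertifiedBlowupAxisymBlowup` (stmt-NavierStokesRegularity-0727), line `compact-amplification`:
# the CONVERSE of the transfer — the crux implies C⁺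

Theorems file (lands `--supports stmt-NavierStokesRegularity-0727`). Together with the reduction
theorem `certifiedBlowupAxisymBlowup_of_amplification` (C⁺ ⇒ crux) this shows that the line's open
stub `stub_amplification` (C⁺: unbounded enstrophy amplification of Tao-class solutions on sub-slabs
of `[0, 1]` over a compact family of axisymmetric Schwartz data) is EQUIVALENT to the crux X5a_axi
(axisymmetric-with-swirl blow-up), not a strengthening of it.

Proof (`amplification_of_certifiedBlowupAxisymBlowup`). Let `(ν, T, u, p)` be the blow-up witness:
`IsMaximalSmoothSolution ν 0 u p T`, Leray–Hopf on `[0, T]` from the rapidly decaying axisymmetric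
datum `u 0`. By `exists_enstrophy_gt_of_isMaximalSmoothSolution` the enstrophy of `u` exceeds any
level at some `t < T`; by `exists_isTaoSolutionOn_of_isMaximalSmoothSolution` the datum has a
Tao-class solution on `[0, t']`, `t < t' < T`, equal to `u` there. The time rescaling
`v(s, x) = c u(c s, x)` with `c = max T 1` (`isTaoSolutionOn_timeRescale`) turns it into a
Tao-class solution with viscosity `c ν` on `[0, t'/c] ⊆ [0, 1]` from the single datum `c • u 0`
(smooth, divergence free, axisymmetric, with the table `c C_{kK}` of `u 0`), whose enstrophy at
`t / c` is `c²` times that of `u` at `t`. The family is the one datum `c • u 0`.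

## References

* T. Tao, *Localisation and compactness properties of the Navier–Stokes global regularity
  problem*, Anal. PDE 6 (2013) = arXiv:1108.1165, Thm. 1.20 and Thm. 5.4.
* P. G. Lemarié-Rieusset, *The Navier–Stokes Problem in the 21st Century*, CRC 2016, Thm. 11.7,
  Thm. 15.1.
-/

set_option linter.dupNamespace false

noncomputable section

open MeasureTheory Set Function Filter Topology
open scoped ENNReal NNReal ContDiff

namespace Summit.NavierStokesRegularity.NavierStokesRegularity.Theorems.CertifiedBlowupAxisymBlowup.CompactAmplification

open Literature.Analysis.FluidPDE
open Summit.NavierStokesRegularity.NavierStokesRegularity.Theses.CertifiedBlowup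

local notation "ℝ³" => EuclideanSpace ℝ (Fin 3)

/-- **The crux implies C⁺ (converse of the line's transfer).** If some finite-energy (Leray–Hopf)
classical Navier–Stokes solution from a rapidly decaying axisymmetric datum is maximal with finite
lifespan (`CertifiedBlowupAxisymBlowup`, X5a_axi), then for some viscosity and some table of
smoothness/decay constants the enstrophy of Tao-class solutions on sub-slabs of `[0, 1]` from
axisymmetric divergence-free smooth data obeying the table is unbounded — verbatim the statement
C⁺ of the registered stub `stub_amplification` of the line `compact-amplification`. The witnesses
are the time-rescaled Tao-class developments of the one blow-up datum (see the module docstring).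
[cite: Tao2011, Thm. 1.20 (vi) and Thm. 5.4] -/
theorem amplification_of_certifiedBlowupAxisymBlowup :
    Summit.NavierStokesRegularity.NavierStokesRegularity.Theses.CertifiedBlowup.CertifiedBlowupAxisymBlowup →
      ∃ ν : ℝ, 0 < ν ∧ ∃ C : ℕ → ℕ → ℝ, ∀ M : ℝ, ∃ T : ℝ, 0 < T ∧ T ≤ 1 ∧
        ∃ (u₀ : EuclideanSpace ℝ (Fin 3) → EuclideanSpace ℝ (Fin 3))
          (u : ℝ → EuclideanSpace ℝ (Fin 3) → EuclideanSpace ℝ (Fin 3))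
          (p : ℝ → EuclideanSpace ℝ (Fin 3) → ℝ),
          ContDiff ℝ ∞ u₀ ∧ VectorCalculus.IsDivFree u₀ ∧ IsAxisymmetric u₀ ∧
          (∀ (k K : ℕ) (x : EuclideanSpace ℝ (Fin 3)),
            (1 + ‖x‖) ^ K * ‖iteratedFDeriv ℝ k u₀ x‖ ≤ C k K) ∧
          IsTaoSolutionOn T ν u₀ u p ∧
          ∃ t ∈ Set.Icc 0 T, ENNReal.ofReal M < ∫⁻ x, ‖fderiv ℝ (u t) x‖ₑ ^ 2 := by
  rintro ⟨ν, hν, T, hT, u, p, hmax, hLH, hdec, hax⟩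
  -- the time-scale `c = max T 1`
  set c : ℝ := max T 1 with hc_def
  have hc1 : 1 ≤ c := le_max_right _ _
  have hc : 0 < c := one_pos.trans_le hc1
  have hTc : T / c ≤ 1 := (div_le_one hc).2 (le_max_left _ _)
  -- the datum
  have h0T : (0 : ℝ) ∈ Ico 0 T := ⟨le_rfl, hT⟩
  have hsm : ContDiff ℝ ∞ (u 0) := hmax.1.contDiff_velocity h0T
  have hdiv : VectorCalculus.IsDivFree (u 0) := hmax.1.divFree 0 h0T
  choose C₀ hC₀ using hdec
  have hdec' : HasRapidSpatialDecay (u 0) := fun k K => ⟨C₀ k K, hC₀ k K⟩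
  refine ⟨c * ν, mul_pos hc hν, fun k K => c * C₀ k K, fun M => ?_⟩
  -- a time of large enstrophy and a Tao-class development beyond it
  obtain ⟨t, ht, hbig⟩ :=
    exists_enstrophy_gt_of_isMaximalSmoothSolution hν hT hmax hLH hdec' (M / c ^ 2)
  set t' : ℝ := (t + T) / 2 with ht'_def
  have ht't : t < t' := by rw [ht'_def]; linarith [ht.2]
  have ht'T : t' < T := by rw [ht'_def]; linarith [ht.2]
  have ht'0 : 0 < t' := ht.1.trans_lt ht't
  obtain ⟨U, P, hU, hUeq⟩ :=
    exists_isTaoSolutionOn_of_isMaximalSmoothSolution hν hT hmax hLH hdec' ht'0 ht'T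
  have hU' := isTaoSolutionOn_timeRescale hU ht'0 hc
  refine ⟨t' / c, div_pos ht'0 hc, (div_le_div_of_nonneg_right ht'T.le hc.le).trans hTc, c • u 0,
    fun s x => c • U (c * s) x, fun s x => c ^ 2 * P (c * s) x, hsm.const_smul c, ?_, ?_, ?_, hU',
    t / c, ⟨div_nonneg ht.1 hc.le, div_le_div_of_nonneg_right ht't.le hc.le⟩, ?_⟩
  · -- divergence free
    intro x
    have hd : DifferentiableAt ℝ (u 0) x := (hsm.differentiable (by simp)).differentiableAt
    show VectorCalculus.divergence (fun y => c • u 0 y) x = 0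
    rw [divergence_const_smul_apply hd, hdiv x, mul_zero]
  · -- axisymmetric
    intro θ x
    show c • u 0 (rotZ θ x) = rotZ θ (c • u 0 x)
    rw [hax θ x, ← rotZL_apply θ (c • u 0 x), map_smul, rotZL_apply]
  · -- the table of `c • u 0`
    intro k K x
    have hiter : iteratedFDeriv ℝ k (c • u 0) x = c • iteratedFDeriv ℝ k (u 0) x :=
      iteratedFDeriv_const_smul_apply ((hsm.of_le (mod_cast le_top)).contDiffAt (n := (k : ℕ∞)))
    rw [hiter, norm_smul, Real.norm_eq_abs, abs_of_pos hc]
    calc (1 + ‖x‖) ^ K * (c * ‖iteratedFDeriv ℝ k (u 0) x‖)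
        = c * ((1 + ‖x‖) ^ K * ‖iteratedFDeriv ℝ k (u 0) x‖) := by ring
      _ ≤ c * C₀ k K := mul_le_mul_of_nonneg_left (hC₀ k K x) hc.le
  · -- the enstrophy at `s = t / c` is `c²` times that of `u` at `t`
    have hct : c * (t / c) = t := mul_div_cancel₀ t hc.ne'
    have hUt : U t = u t := hUeq t ⟨ht.1, ht't.le⟩
    have hslice : (fun s x => c • U (c * s) x) (t / c) = c • u t := by
      funext x
      simp only [hct, hUt]
      rfl
    rw [hslice]
    have hd : Differentiable ℝ (u t) := (hmax.1.contDiff_velocity ht).differentiable (by simp)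
    have hfd : ∀ x, fderiv ℝ (c • u t) x = c • fderiv ℝ (u t) x := fun x =>
      fderiv_const_smul (hd x) c
    have hI : ∫⁻ x, ‖fderiv ℝ (c • u t) x‖ₑ ^ 2 =
        ENNReal.ofReal (c ^ 2) * ∫⁻ x, ‖fderiv ℝ (u t) x‖ₑ ^ 2 := by
      rw [← lintegral_const_mul' _ _ ENNReal.ofReal_ne_top]
      refine lintegral_congr fun x => ?_
      rw [hfd x, enorm_smul, mul_pow, Real.enorm_eq_ofReal hc.le, ENNReal.ofReal_pow hc.le]
    rw [hI]
    have hc2 : (0 : ℝ) < c ^ 2 := by positivity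
    have h1 : ENNReal.ofReal M ≤ ENNReal.ofReal (c ^ 2) * ENNReal.ofReal (M / c ^ 2) := by
      rw [← ENNReal.ofReal_mul hc2.le, mul_div_cancel₀ M hc2.ne']
    exact h1.trans_lt (ENNReal.mul_lt_mul_right (ENNReal.ofReal_pos.2 hc2).ne'
      ENNReal.ofReal_ne_top hbig)

end Summit.NavierStokesRegularity.NavierStokesRegularity.Theorems.CertifiedBlowupAxisymBlowup.CompactAmplification

end
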